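import Literature.NumberTheory.EllipticCurves.Kobayashi2003.SignedSelmer
import Literature.NumberTheory.EllipticCurves.SelmerPInftyRelModelAction
import HarnessLib

/-!
# Kobayashi 2003, §2 / Def. 2.1 / §4 p. 8 — the OBJECTS over the tower `K_n = ℚ(ζ_{p^{n+1}})`:
# `E^±(K_{n,v})` WITH the `m = −1` clause, `Sel^±(E/K_n)`, `Sel^±(E/K_∞)`, the `η`-component
# `Sel^±(E/K_∞)^η` of a quadratic character `η` of `Δ = Gal(ℚ(μ_p)/ℚ)`, and the Pontryagin dual
# `X^±(E/K_∞)^η` as a hypothesis structure (LITERATURE HOME of the object; definitions only)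

WHAT THIS FILE IS. The PROMOTION COPY into `Literature/` of the two Summits-side vocabulary files of
cell `b2b-bsdres` (seat cc-typer-6, GEN 8): `Summits/…/Rank1Residual/Additive/CyclotomicTowerSignedLocal.lean`
(p277557, "FILE 1", the local part) and `…/Additive/CyclotomicTowerSignedSelmer.lean` (p279794, "FILE 2",
the global part), requested for promotion by their author on 2026-08-21 (`ledger promote request`,
events 6916077 / 6916103; plan of record `run/shared/lean/b2b/bsd-rank1-residual/class-closure/typer-6/
P5-FIRST-SAY-typer6.md` (Q1).3: "FILES 1–3 of the (B′) object … import ONLY Literature … and are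
stated in Mathlib generality …; they ARE the 'TODO(general form): the `K`-tower with
`Δ`-eigencomponents (Def. 2.1 variant)' that `Literature/…/Kobayashi2003/SignedKatoDivisibility.lean`
names, and belong in `Literature/NumberTheory/EllipticCurves/Kobayashi2003/` beside Def. 1.1's
objects"). Both originals import Literature only; their declarations are copied here with
IDENTICAL BODIES (so the Summits originals are definitionally equal to these, term for term, and a
Theorems-side bridge is `rfl`), the namespace becoming the path namespace
`Literature.NumberTheory.EllipticCurves.Kobayashi2003`. One instance is renamed
(`finiteIndex_localSubgroupOfEmb_of_finiteIndex`, to avoid the short name of the `[H.Normal]`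
variant `Literature.NumberTheory.EllipticCurves.finiteIndex_localSubgroupOfEmb`). No refactor of the
Summits originals or their importers is done or implied (sequencing condition of the promote
request). WHY NOW (cell `bsd-cm`, seat `bsd-cm-k8i-ty`, D-0074 group (G); K8 route
`InertBadSignedBranches`, item stmt-BirchSwinnertonDyer-19226 `PrintReadingsInert`): the printed
theorems Kobayashi 2003 Thm. 2.2 / Thm. 4.1 (third display) / Thm. 7.4 at `η` and Kitajima–Otsuki
2018 Main Thm. 1.3 (sign `−`) are statements about `X^±(E/K_∞)^η`; a named Literature fact can only
be written on a Literature-homed object (a Literature file never imports `Summits`). The facts live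
in the sibling file `SignedSelmerEtaComponentFacts.lean`; THIS file is VOCABULARY ONLY — definitions
with bodies + proved unfolding / stability lemmas + ONE hypothesis structure; NOTHING is asserted
(Thm. 2.2 / 4.1 / 7.4, Kitajima–Otsuki are NOT stated here); no named fact; no `sorry`.

## Source, verbatim (Kobayashi, Invent. Math. 152 (2003) [Kobayashi2003], held copy
## `paper:doi-10-1007-s00222-002-0265-4`, pp. 4, 5, 8 — re-read by this seat 2026-08-26)

p. 4: "Let `p` be an odd prime number. … We denote `K_n = ℚ(ζ_{p^{n+1}})`, `K_{−1} = ℚ` and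
`K_∞ = ∪_n K_n`. Let `E` be an elliptic curve over `ℚ` with good reduction at `p`. We assume that
`a_p = 0`. … We define subgroups `E^±(K_{n,v})` of `E(K_{n,v})` by
`E⁺(K_{n,v}) = {P ∈ E(K_{n,v}) | Tr_{n/m+1} P ∈ E(K_{m,v}) for even m (0 ≤ m < n)}`,
`E⁻(K_{n,v}) = {P ∈ E(K_{n,v}) | Tr_{n/m+1} P ∈ E(K_{m,v}) for odd m (−1 ≤ m < n)}`,
where `Tr_{n/m+1} : E(K_{n,v}) → E(K_{m+1,v})` is the trace map. … We regard
`E(K_{n,v}) ⊗ ℚ_p/ℤ_p` as a subgroup of `H¹(K_{n,v}, E[p^∞])` by the Kummer map."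
p. 5: "**Definition 2.1.** The even (odd) Selmer group is defined by
`Sel^±(E/K_n) := Ker( H¹(K_n, E[p^∞]) → ∏_v H¹(K_{n,v}, E[p^∞]) / E^±(K_{n,v}) ⊗ ℚ_p/ℤ_p )` and
`Sel^±(E/K_∞) := lim→_n Sel^±(E/K_n)`. … We denote the Pontryagin dual of Selmer groups by “X”. …
Let `G_n = Gal(K_n/ℚ)` and `G_∞ = lim← G_n`. Then `Λ_n = ℤ_p[G_n]` acts naturally on `X^±(E/K_n)`
and `Λ = ℤ_p[[G_∞]]` on `X^±(E/K_∞)`." p. 5 (§3): "`G_∞ = Δ × Γ`, where `Δ ≅ ℤ/(p−1)ℤ` and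
`Γ ≅ ℤ_p`. We fix a topological generator `γ ∈ Γ`. Then we identify `ℤ_p[[Γ]]` with `ℤ_p[[X]]` …
by identifying `γ` with `1 + X`." p. 6: "Let `η : Δ → ℤ_p^×` be a character … We regard `η` as a
character of `G_∞` by taking `η(γ) = 1`." p. 8: "For a `ℤ_p[Δ]`-module `M`, let `M^η` denote the
`η`-component of `M`. If we denote `ε_η = (1/♯Δ) ∑_{τ∈Δ} η^{−1}(τ) τ`, `M^η` is given by `ε_η M`.
… By Theorem 2.2, `X^±(E/K_∞)^η` is a torsion `ℤ_p[[Γ]]`-module."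

## Transcription (unchanged from the originals; everything inside ONE absolute Galois group `Γ_K`)

General data: a number field `K`, `κ : ZpExtension K p` (layers `K_n^κ`, `K_∞^κ`), a number field
`K₀/K` with `Gal(K̄/K₀) = galRange K₀` NORMAL in `Γ_K` (instance hypothesis), a model `E` of the
completion of `K` at the place above `p` and a `K`-embedding `ι : K̄ → K̄_E`. Kobayashi: `K = ℚ`,
`κ` cyclotomic, `K₀ = ℚ(μ_p)`, `E = ℚ_[p]`, `ι = closureEmb`; then `K₀·ℚ_n = ℚ(ζ_{p^{n+1}}) = K_n`,
`K₀·ℚ_∞ = K_∞`, and `Δ = Gal(K_0/ℚ) ≅ Gal(K_∞/ℚ_∞) = ker κ / (ker κ ⊓ galRange K₀)`.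
* §1 `localFixedPointsOfEmb ι W H = E(K̄_E)^{(Γ_E → Γ_K)⁻¹ H}` (`H = U n`: `E(K_{n,v})`; `H = ⊤`:
  `E(K_{−1,v}) = E(E)`); the tree's `localLayerPointsOfEmb κ ι W n` is the case `H = κ.layerSubgroup n`
  (`rfl`).
* §2 ONE generic trace `localPairTraceOfEmb ι W H₁ H₂` for a pair of subgroups, `H₂` of finite index
  (`P ↦ ∑_q q̃ • P` over representatives of `(H₁)_E / ((H₂)_E ∩ (H₁)_E)`); on `E(L₂,w)` the trace of
  the source, on `E(L₁,w)` multiplication by the index; the tree's `localTraceOfEmb κ ι W m n` is the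
  pair `(κ.layerSubgroup m, κ.layerSubgroup n)` (`rfl`).
* §3 `towerSignedLocalPointsOfEmb U ι W ε n = E^ε(K_{n,v})` over a tower `U : ℕ → Subgroup Γ_K` —
  §2 p. 4 VERBATIM: `Tr_{n/m+1} P ∈ E(K_{m,v})` for every `m < n` with `(−1)^m = ε` (`0 ≤ m`), AND,
  for `ε = −1` (the value `m = −1` is odd), `Tr_{n/0} P ∈ E(K_{−1,v})` (`localFixedPointsOfEmb ι W ⊤`).
* §4 the tower `towerSubgroup κ K₀ n = κ.layerSubgroup n ⊓ galRange K₀ = Gal(K̄/K₀·K_n^κ)`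
  (Kobayashi's `Gal(ℚ̄/K_n)`), `towerTopSubgroup κ K₀ = ker κ ⊓ galRange K₀ = Gal(K̄/K₀·K_∞^κ)`.
* §5 `towerSignedSelmerLayer W κ K₀ E ε n = Sel^ε(E/K_n)` (Def. 2.1: the classical Selmer group of
  the fixed field of `towerSubgroup n` — `selmerGroupOver`, all places — cut, at the model `E` and
  every `Γ_K`-conjugate, to the classes whose restriction lies in the Kummer image of §3's
  `E^ε(K_{n,v})` WITH the `m = −1` clause; at `v ∤ p` the signed and the classical condition agree, so
  imposing the signed condition above `p` only IS Def. 2.1); `towerSignedSelmerInfty = Sel^ε(E/K_∞) =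
  ⋃_n` images; PROVED: `≤` the classical groups, stability under `conj_γ`.
* §6 `towerSignedSelmerInftyEta W κ K₀ E η ε = Sel^ε(E/K_∞)^η` for a character `η : Γ_K →* ℤˣ`
  (read on `ker κ = Gal(K̄/K_∞^κ) ↠ Δ`): the classes `s` with `conj_σ s = η(σ)·s` for all `σ ∈ ker κ`
  — `ε_η M` for `η` of order `≤ 2` (`η = ω^{(p−1)/2}`, the character of `ℚ(√p*) ⊂ K₀`, is the
  odd-branch instance; `η = 1` gives `M^Δ`). TODO(general form): `η` of order dividing `p − 1`
  with values in `ℤ_p^×` needs a `ℤ_p`-module structure on `H¹` that the tree does not carry.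
* §7 `EtaSignedSelmerDualData W κ K₀ E η γ ε` — `X^ε(E/K_∞)^η = Hom(Sel^ε(E/K_∞)^η, ℚ_p/ℤ_p)` as a
  `Λ = ℤ_p⟦T⟧`-module, `T ↔ conj_γ − 1` for `γ ∈ Gal(K̄/K₀)` with `κ γ` a generator, field for field
  the tree's `Kobayashi2003.SignedSelmerDualData`; `charIdeal`, `mu`, `lambda`. For `η² = 1` the two
  conventions for the `Δ`-action on the dual give the same `η`-component. EXISTENCE (non-vacuity)
  is proved Summits-side for the definitionally equal original (`…/Additive/CyclotomicTowerSignedSelmerDual.lean`,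
  p281115) and is not restated here; finite generation / torsion (Thm. 2.2) is a FACT of the
  sibling facts file, not a field.

What is NOT here: any theorem of the source (Thm. 2.2, 4.1, 7.4), Kitajima–Otsuki, Pollack's
functions; the `χ`-twisted variant (`…/Additive/CyclotomicTowerSignedSelmerChi.lean` stays
Summits-side); any refactor of the Summits originals.

References: [Kobayashi2003] S. Kobayashi, Invent. Math. 152 (2003) 1–36: §2 p. 4, Def. 2.1 (p. 5),
§3 p. 5–6, §4 p. 8, Def. 1.1 (p. 2); [GreenbergLNM1716] §1 (p. 60); [SerreGaloisCohomology1997]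
II.§1.1 (local subgroups at an embedding).
-/

noncomputable section

open scoped Classical

universe u

namespace Literature.NumberTheory.EllipticCurves.Kobayashi2003

open Literature.NumberTheory.EllipticCurves Literature.NumberTheory.GaloisRepresentations ZpExtension

/-! ## §1 Local fixed points of a subgroup `H ≤ Γ_K` at an embedding -/

section Fixed

variable {K : Type u} [Field K] {E : Type u} [Field E] [Algebra K E]
  (ι : AlgebraicClosure K →ₐ[K] AlgebraicClosure E) (W : WeierstrassCurve K)

/-- Finite index passes from `H ≤ Γ_K` to the local subgroup `H_E = (Γ_E → Γ_K)⁻¹(H) ≤ Γ_E`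
(`Subgroup.index_comap`: `[Γ_E : H_E] = [im : im ∩ H]`, non-zero when `[Γ_K : H]` is). For
`H = Gal(K̄/L)`: `[L_w : K_v] ≤ [L : K]`. Serre, *Galois Cohomology*, II.§1.1. [folklore] -/
instance finiteIndex_localSubgroupOfEmb_of_finiteIndex (H : Subgroup (Field.absoluteGaloisGroup K))
    [H.FiniteIndex] : (localSubgroupOfEmb H ι).FiniteIndex :=
  ⟨fun h => Subgroup.FiniteIndex.index_ne_zero (H := H)
    (H.index_eq_zero_of_relIndex_eq_zero (by rwa [localSubgroupOfEmb, Subgroup.index_comap] at h))⟩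

/-- **`E(L_w)` inside `E(K̄_E)`** for `H = Gal(K̄/L) ≤ Γ_K`: the points of `W` over `K̄_E` fixed by the
local subgroup `H_E = (Γ_E → Γ_K)⁻¹(H)` attached to `ι` (Mathlib `FixedPoints.addSubgroup`). For
Kobayashi's tower (`H = Gal(ℚ̄/K_n)`, `E = ℚ_p`): `E(K_{n,v})`; for `H = ⊤` (`K_{−1} = ℚ`):
`E(K_{−1,v}) = E(ℚ_p)`. [cite: Kobayashi2003, §2 p. 4 (the groups E(K_{n,v}), K_{−1} = ℚ)] -/
def localFixedPointsOfEmb (H : Subgroup (Field.absoluteGaloisGroup K)) :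
    AddSubgroup (localPoints W E) :=
  FixedPoints.addSubgroup (localSubgroupOfEmb H ι) (localPoints W E)

/-- Membership in `E(L_w)`: fixed by every `τ ∈ H_E`. [cite: Kobayashi2003, §2 p. 4] -/
theorem mem_localFixedPointsOfEmb_iff (H : Subgroup (Field.absoluteGaloisGroup K))
    (P : localPoints W E) :
    P ∈ localFixedPointsOfEmb ι W H ↔
      ∀ τ : Field.absoluteGaloisGroup E, τ ∈ localSubgroupOfEmb H ι → τ • P = P := by
  rw [localFixedPointsOfEmb, FixedPoints.mem_addSubgroup, Subtype.forall]
  rfl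

/-- Smaller subgroup (larger field), more points: `H ≤ H' → E((H')-field) ≤ E(H-field)`, i.e. the
assignment `H ↦ E(L_w)` is antitone (`E(K_{m,v}) ≤ E(K_{n,v})` for `m ≤ n`).
[cite: Kobayashi2003, §2 p. 4] -/
theorem localFixedPointsOfEmb_antitone : Antitone (localFixedPointsOfEmb ι W) := by
  intro H H' h P hP
  rw [mem_localFixedPointsOfEmb_iff] at hP ⊢
  exact fun τ hτ => hP τ (Subgroup.comap_mono h hτ)

/-- `E(K_{−1,v}) = E(E)`: for `H = ⊤` the points fixed by ALL of `Γ_E` (`(⊤)_E = ⊤`).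
[cite: Kobayashi2003, §2 p. 4 (K_{−1} = ℚ)] -/
theorem mem_localFixedPointsOfEmb_top_iff (P : localPoints W E) :
    P ∈ localFixedPointsOfEmb ι W ⊤ ↔ ∀ τ : Field.absoluteGaloisGroup E, τ • P = P := by
  rw [mem_localFixedPointsOfEmb_iff]
  simp only [localSubgroupOfEmb, Subgroup.comap_top, Subgroup.mem_top, forall_const]

/-- `E(K_{−1,v}) ≤ E(L_w)` for every `H`. [cite: Kobayashi2003, §2 p. 4] -/
theorem localFixedPointsOfEmb_top_le (H : Subgroup (Field.absoluteGaloisGroup K)) :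
    localFixedPointsOfEmb ι W ⊤ ≤ localFixedPointsOfEmb ι W H :=
  localFixedPointsOfEmb_antitone ι W le_top

/-- **Compatibility with the tree's `F_n`-tower**: `localLayerPointsOfEmb κ ι W n` (Def. 1.1's
`E(F_{n,p})`) IS `localFixedPointsOfEmb ι W (κ.layerSubgroup n)` (definitional).
[cite: Kobayashi2003, Def. 1.1 and §2 p. 4] -/
theorem localLayerPointsOfEmb_eq {p : ℕ} [Fact p.Prime] (κ : ZpExtension K p) (n : ℕ) :
    localLayerPointsOfEmb κ ι W n = localFixedPointsOfEmb ι W (κ.layerSubgroup n) :=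
  rfl

end Fixed

/-! ## §2 ONE generic trace for a pair of finite-index subgroups -/

section Trace

variable {K : Type u} [Field K] {E : Type u} [Field E] [Algebra K E]
  (ι : AlgebraicClosure K →ₐ[K] AlgebraicClosure E) (W : WeierstrassCurve K)

/-- The relative quotient `(H₁)_E / ((H₂)_E ∩ (H₁)_E)` (a copy of `Gal(L₂,w / L₁,w)` when `H₂ ≤ H₁`)
is finite when `H₂` has finite index. [folklore] -/
instance finite_localPairQuotient (H₁ H₂ : Subgroup (Field.absoluteGaloisGroup K)) [H₂.FiniteIndex] :
    Finite (localSubgroupOfEmb H₁ ι ⧸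
      (localSubgroupOfEmb H₂ ι).subgroupOf (localSubgroupOfEmb H₁ ι)) :=
  Subgroup.finite_quotient_of_finiteIndex

/-- **The trace `Tr_{L₂/L₁}` at the embedding `ι`** for a pair of subgroups `H₁ = Gal(K̄/L₁)`,
`H₂ = Gal(K̄/L₂)` of `Γ_K`, `H₂` of finite index: the endomorphism `P ↦ ∑_q q̃ • P` of `E(K̄_E)`,
summed over chosen representatives (`Quotient.out`) of `(H₁)_E / ((H₂)_E ∩ (H₁)_E)`. On
`P ∈ E(L₂,w)` (fixed by `(H₂)_E`) and for `H₂ ≤ H₁` this is the trace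
`Tr_{L₂,w/L₁,w} P = ∑_{σ ∈ Gal(L₂,w/L₁,w)} σP ∈ E(L₁,w)` of the source ("`Tr_{n/m+1} : E(K_{n,v}) →
E(K_{m+1,v})` is the trace map", §2 p. 4), independent of the representatives
(`localPairTraceOfEmb_apply_eq_sum_of_mem`); elsewhere a documented junk value. The tree's
`localTraceOfEmb κ ι W m n` is the pair `(κ.layerSubgroup m, κ.layerSubgroup n)`
(`localTraceOfEmb_eq_localPairTraceOfEmb`). [cite: Kobayashi2003, §2 p. 4 (the trace maps Tr_{n/m+1})] -/
def localPairTraceOfEmb (H₁ H₂ : Subgroup (Field.absoluteGaloisGroup K)) [H₂.FiniteIndex] :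
    localPoints W E →+ localPoints W E :=
  haveI := Fintype.ofFinite (localSubgroupOfEmb H₁ ι ⧸
    (localSubgroupOfEmb H₂ ι).subgroupOf (localSubgroupOfEmb H₁ ι))
  ∑ q : localSubgroupOfEmb H₁ ι ⧸ (localSubgroupOfEmb H₂ ι).subgroupOf (localSubgroupOfEmb H₁ ι),
    DistribSMul.toAddMonoidHom (localPoints W E)
      ((q.out : localSubgroupOfEmb H₁ ι) : Field.absoluteGaloisGroup E)

variable (H₁ H₂ : Subgroup (Field.absoluteGaloisGroup K)) [H₂.FiniteIndex]

/-- Unfolding the trace: `Tr P = ∑_q q.out • P` (any `Fintype` instance on the quotient).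
[cite: Kobayashi2003, §2 p. 4] -/
theorem localPairTraceOfEmb_apply
    [Fintype (localSubgroupOfEmb H₁ ι ⧸
      (localSubgroupOfEmb H₂ ι).subgroupOf (localSubgroupOfEmb H₁ ι))]
    (P : localPoints W E) :
    localPairTraceOfEmb ι W H₁ H₂ P =
      ∑ q : localSubgroupOfEmb H₁ ι ⧸ (localSubgroupOfEmb H₂ ι).subgroupOf (localSubgroupOfEmb H₁ ι),
        ((q.out : localSubgroupOfEmb H₁ ι) : Field.absoluteGaloisGroup E) • P := by
  rw [localPairTraceOfEmb, AddMonoidHom.finsetSum_apply]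
  exact Finset.sum_congr (by convert rfl) fun q _ => rfl

/-- **Compatibility with the tree's `F_n`-tower trace**: `localTraceOfEmb κ ι W m n` (Def. 1.1's
`Tr_{n/m}`) IS `localPairTraceOfEmb ι W (κ.layerSubgroup m) (κ.layerSubgroup n)` (definitional, for
any finite-index instance on the layer subgroup). [cite: Kobayashi2003, Def. 1.1 and §2 p. 4] -/
theorem localTraceOfEmb_eq_localPairTraceOfEmb {p : ℕ} [Fact p.Prime] (κ : ZpExtension K p)
    (m n : ℕ) [(κ.layerSubgroup n).FiniteIndex] :
    localTraceOfEmb κ ι W m n = localPairTraceOfEmb ι W (κ.layerSubgroup m) (κ.layerSubgroup n) :=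
  rfl

variable {H₁ H₂} in
omit [H₂.FiniteIndex] in
/-- For `P ∈ E(L₂,w)` the summand `q.out • P` only depends on the coset `q`: any representative
`σ` of `q` gives `σ • P`. [cite: Kobayashi2003, §2 p. 4] -/
theorem out_smul_eq_of_mem_localFixedPointsOfEmb {P : localPoints W E}
    (hP : P ∈ localFixedPointsOfEmb ι W H₂) (σ : localSubgroupOfEmb H₁ ι) :
    ((QuotientGroup.mk (s := (localSubgroupOfEmb H₂ ι).subgroupOf
        (localSubgroupOfEmb H₁ ι)) σ).out : Field.absoluteGaloisGroup E) • P =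
      (σ : Field.absoluteGaloisGroup E) • P := by
  obtain ⟨h, hh⟩ := QuotientGroup.mk_out_eq_mul
    ((localSubgroupOfEmb H₂ ι).subgroupOf (localSubgroupOfEmb H₁ ι)) σ
  rw [hh, Subgroup.coe_mul, mul_smul]
  congr 1
  exact (mem_localFixedPointsOfEmb_iff ι W H₂ P).mp hP _ (Subgroup.mem_subgroupOf.mp h.2)

variable {H₁ H₂} in
/-- **Independence of representatives.** For `P ∈ E(L₂,w)` and ANY section `s` of
`(H₁)_E → (H₁)_E / ((H₂)_E ∩ (H₁)_E)`, `Tr P = ∑_q s(q) • P`. [cite: Kobayashi2003, §2 p. 4] -/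
theorem localPairTraceOfEmb_apply_eq_sum_of_mem
    [Fintype (localSubgroupOfEmb H₁ ι ⧸
      (localSubgroupOfEmb H₂ ι).subgroupOf (localSubgroupOfEmb H₁ ι))]
    {P : localPoints W E} (hP : P ∈ localFixedPointsOfEmb ι W H₂)
    (s : localSubgroupOfEmb H₁ ι ⧸ (localSubgroupOfEmb H₂ ι).subgroupOf (localSubgroupOfEmb H₁ ι) →
      localSubgroupOfEmb H₁ ι)
    (hs : ∀ q, (QuotientGroup.mk (s q) : _ ⧸ _) = q) :
    localPairTraceOfEmb ι W H₁ H₂ P =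
      ∑ q, ((s q : localSubgroupOfEmb H₁ ι) : Field.absoluteGaloisGroup E) • P := by
  rw [localPairTraceOfEmb_apply]
  refine Finset.sum_congr rfl fun q _ => ?_
  conv_lhs => rw [← hs q]
  exact out_smul_eq_of_mem_localFixedPointsOfEmb ι W hP (s q)

variable {H₁ H₂} in
/-- `Tr P ∈ E(L₁,w)` for `P ∈ E(L₂,w)`: left multiplication by `τ ∈ (H₁)_E` permutes the cosets
("`Tr_{n/m+1} : E(K_{n,v}) → E(K_{m+1,v})`"). [cite: Kobayashi2003, §2 p. 4] -/
theorem localPairTraceOfEmb_mem_of_mem {P : localPoints W E}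
    (hP : P ∈ localFixedPointsOfEmb ι W H₂) :
    localPairTraceOfEmb ι W H₁ H₂ P ∈ localFixedPointsOfEmb ι W H₁ := by
  classical
  set N := (localSubgroupOfEmb H₂ ι).subgroupOf (localSubgroupOfEmb H₁ ι) with hN
  haveI : Fintype (localSubgroupOfEmb H₁ ι ⧸ N) := Fintype.ofFinite _
  rw [mem_localFixedPointsOfEmb_iff]
  intro τ hτ
  rw [localPairTraceOfEmb_apply, Finset.smul_sum]
  have key : ∀ q : localSubgroupOfEmb H₁ ι ⧸ N,
      τ • (((q.out : localSubgroupOfEmb H₁ ι) : Field.absoluteGaloisGroup E) • P) =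
        ((((⟨τ, hτ⟩ : localSubgroupOfEmb H₁ ι) • q).out : localSubgroupOfEmb H₁ ι) :
          Field.absoluteGaloisGroup E) • P := by
    intro q
    have h1 : (⟨τ, hτ⟩ : localSubgroupOfEmb H₁ ι) • q =
        QuotientGroup.mk (s := N) (⟨τ, hτ⟩ * q.out) := by
      conv_lhs => rw [← QuotientGroup.out_eq' q]
      rfl
    rw [h1, out_smul_eq_of_mem_localFixedPointsOfEmb ι W hP, Subgroup.coe_mul, mul_smul]
  simp_rw [key]
  exact Fintype.sum_equiv (MulAction.toPerm (⟨τ, hτ⟩ : localSubgroupOfEmb H₁ ι)) _ _ fun q => rfl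

variable {H₁ H₂} in
/-- On `E(L₁,w)` (points already fixed by the larger group `(H₁)_E`) the trace is multiplication by
the index `[(H₁)_E : (H₂)_E ∩ (H₁)_E]` (`= [L₂,w : L₁,w]` for `H₂ ≤ H₁`).
[cite: Kobayashi2003, §2 p. 4] -/
theorem localPairTraceOfEmb_apply_of_mem_lower {P : localPoints W E}
    (hP : P ∈ localFixedPointsOfEmb ι W H₁) :
    localPairTraceOfEmb ι W H₁ H₂ P =
      ((localSubgroupOfEmb H₂ ι).subgroupOf (localSubgroupOfEmb H₁ ι)).index • P := by
  classical
  set N := (localSubgroupOfEmb H₂ ι).subgroupOf (localSubgroupOfEmb H₁ ι)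
  haveI : Fintype (localSubgroupOfEmb H₁ ι ⧸ N) := Fintype.ofFinite _
  rw [localPairTraceOfEmb_apply]
  have : ∀ q : localSubgroupOfEmb H₁ ι ⧸ N,
      (((q.out : localSubgroupOfEmb H₁ ι) : Field.absoluteGaloisGroup E)) • P = P :=
    fun q => (mem_localFixedPointsOfEmb_iff ι W H₁ P).mp hP _ q.out.2
  simp_rw [this, Finset.sum_const, Finset.card_univ, Subgroup.index, Nat.card_eq_fintype_card]
  rfl

/-- `Tr_{L/L} P = P` for `P ∈ E(L_w)`. [cite: Kobayashi2003, §2 p. 4] -/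
theorem localPairTraceOfEmb_self_of_mem (H : Subgroup (Field.absoluteGaloisGroup K)) [H.FiniteIndex]
    {P : localPoints W E} (hP : P ∈ localFixedPointsOfEmb ι W H) :
    localPairTraceOfEmb ι W H H P = P := by
  rw [localPairTraceOfEmb_apply_of_mem_lower ι W hP, Subgroup.subgroupOf_self, Subgroup.index_top,
    one_smul]

end Trace

/-! ## §3 Kobayashi's `E^±(K_{n,v})` over a tower of subgroups, WITH the `m = −1` clause -/

section Signed

variable {K : Type u} [Field K] {E : Type u} [Field E] [Algebra K E]
  (U : ℕ → Subgroup (Field.absoluteGaloisGroup K)) [hU : ∀ n, (U n).FiniteIndex]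
  (ι : AlgebraicClosure K →ₐ[K] AlgebraicClosure E) (W : WeierstrassCurve K)

/-- **Kobayashi's `E^ε(K_{n,v})` over the tower `U`** (`U n = Gal(K̄/K_n)`, `K_{−1} = K` the
subgroup `⊤`; `ε = 1`: `E⁺`, `ε = −1`: `E⁻`), §2 p. 4 VERBATIM:
`E⁺(K_{n,v}) = {P ∈ E(K_{n,v}) | Tr_{n/m+1} P ∈ E(K_{m,v}) for even m (0 ≤ m < n)}`,
`E⁻(K_{n,v}) = {P ∈ E(K_{n,v}) | Tr_{n/m+1} P ∈ E(K_{m,v}) for odd m (−1 ≤ m < n)}` —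
i.e. the points `P ∈ E(K_{n,v})` (`localFixedPointsOfEmb ι W (U n)`) with
`Tr_{n/m+1} P ∈ E(K_{m,v})` for every natural `m < n` with `(−1)^m = ε`, AND, when `ε = −1` (the
value `m = −1` is odd and allowed), `Tr_{n/0} P ∈ E(K_{−1,v}) = E(E)` (`localFixedPointsOfEmb ι W ⊤`).
NO surrogate (not "torsion", not "`= 0`"): the clause exactly as printed, on the `V`-side. An
additive subgroup (traces are additive, fixed points are subgroups). For `K = ℚ`,
`U n = Gal(ℚ̄/ℚ(ζ_{p^{n+1}}))`, `E = ℚ_p`, `ι = closureEmb`: the groups `E^±(K_{n,v})` of the source.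
[cite: Kobayashi2003, §2 p. 4 (definition of E^±(K_{n,v}), K_{−1} = ℚ)] -/
def towerSignedLocalPointsOfEmb (ε : ℤˣ) (n : ℕ) : AddSubgroup (localPoints W E) where
  carrier := {P | P ∈ localFixedPointsOfEmb ι W (U n) ∧
    (∀ m < n, (m : ℤ).negOnePow = ε →
      localPairTraceOfEmb ι W (U (m + 1)) (U n) P ∈ localFixedPointsOfEmb ι W (U m)) ∧
    (ε = -1 → localPairTraceOfEmb ι W (U 0) (U n) P ∈ localFixedPointsOfEmb ι W ⊤)}
  zero_mem' := ⟨zero_mem _, fun m _ _ => by rw [map_zero]; exact zero_mem _,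
    fun _ => by rw [map_zero]; exact zero_mem _⟩
  add_mem' := fun {P Q} hP hQ => ⟨add_mem hP.1 hQ.1, fun m hm hε => by
      rw [map_add]; exact add_mem (hP.2.1 m hm hε) (hQ.2.1 m hm hε),
    fun hε => by rw [map_add]; exact add_mem (hP.2.2 hε) (hQ.2.2 hε)⟩
  neg_mem' := fun {P} hP => ⟨neg_mem hP.1, fun m hm hε => by
      rw [map_neg]; exact neg_mem (hP.2.1 m hm hε),
    fun hε => by rw [map_neg]; exact neg_mem (hP.2.2 hε)⟩

/-- Membership in `E^ε(K_{n,v})` (§2 p. 4 unfolded). [cite: Kobayashi2003, §2 p. 4] -/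
theorem mem_towerSignedLocalPointsOfEmb_iff (ε : ℤˣ) (n : ℕ) (P : localPoints W E) :
    P ∈ towerSignedLocalPointsOfEmb U ι W ε n ↔ P ∈ localFixedPointsOfEmb ι W (U n) ∧
      (∀ m < n, (m : ℤ).negOnePow = ε →
        localPairTraceOfEmb ι W (U (m + 1)) (U n) P ∈ localFixedPointsOfEmb ι W (U m)) ∧
      (ε = -1 → localPairTraceOfEmb ι W (U 0) (U n) P ∈ localFixedPointsOfEmb ι W ⊤) :=
  Iff.rfl

/-- `E^ε(K_{n,v}) ≤ E(K_{n,v})`. [cite: Kobayashi2003, §2 p. 4] -/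
theorem towerSignedLocalPointsOfEmb_le (ε : ℤˣ) (n : ℕ) :
    towerSignedLocalPointsOfEmb U ι W ε n ≤ localFixedPointsOfEmb ι W (U n) :=
  fun _ hP => hP.1

/-- **The plus side, verbatim**: "`Tr_{n/m+1} P ∈ E(K_{m,v})` for even `m (0 ≤ m < n)`" — NO
`m = −1` clause (`−1` is odd; `(−1)^m = 1 ↔ m` even). [cite: Kobayashi2003, §2 p. 4] -/
theorem mem_towerSignedLocalPointsOfEmb_one_iff (n : ℕ) (P : localPoints W E) :
    P ∈ towerSignedLocalPointsOfEmb U ι W 1 n ↔ P ∈ localFixedPointsOfEmb ι W (U n) ∧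
      ∀ m < n, Even m →
        localPairTraceOfEmb ι W (U (m + 1)) (U n) P ∈ localFixedPointsOfEmb ι W (U m) := by
  have h : (1 : ℤˣ) ≠ -1 := by decide
  simp only [mem_towerSignedLocalPointsOfEmb_iff, Int.negOnePow_eq_one_iff, Int.even_coe_nat, h,
    IsEmpty.forall_iff, and_true]

/-- **The minus side, verbatim**: "`Tr_{n/m+1} P ∈ E(K_{m,v})` for odd `m (−1 ≤ m < n)`" = the odd
`0 ≤ m < n` conditions (`(−1)^m = −1 ↔ m` odd) AND the `m = −1` clause `Tr_{n/0} P ∈ E(K_{−1,v})`.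
[cite: Kobayashi2003, §2 p. 4] -/
theorem mem_towerSignedLocalPointsOfEmb_neg_one_iff (n : ℕ) (P : localPoints W E) :
    P ∈ towerSignedLocalPointsOfEmb U ι W (-1) n ↔ P ∈ localFixedPointsOfEmb ι W (U n) ∧
      (∀ m < n, Odd m →
        localPairTraceOfEmb ι W (U (m + 1)) (U n) P ∈ localFixedPointsOfEmb ι W (U m)) ∧
      localPairTraceOfEmb ι W (U 0) (U n) P ∈ localFixedPointsOfEmb ι W ⊤ := by
  simp only [mem_towerSignedLocalPointsOfEmb_iff, Int.negOnePow_eq_neg_one_iff, Int.odd_coe_nat,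
    forall_const]

/-- `E⁺(K_{0,v}) = E(K_{0,v})`: no condition at the bottom layer on the plus side.
[cite: Kobayashi2003, §2 p. 4] -/
theorem towerSignedLocalPointsOfEmb_one_zero :
    towerSignedLocalPointsOfEmb U ι W 1 0 = localFixedPointsOfEmb ι W (U 0) := by
  ext P
  simp [mem_towerSignedLocalPointsOfEmb_one_iff]

/-- **`E⁻(K_{0,v}) = E(K_{−1,v})`**: at `n = 0` the only odd `m` with `−1 ≤ m < 0` is `m = −1`, and
`Tr_{0/0} P = P` (`localPairTraceOfEmb_self_of_mem`), so the minus group at the bottom layer is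
`E(K_{−1,v}) ∩ E(K_{0,v}) = E(K_{−1,v})` (`= E(ℚ_p)`; on an `η ≠ 1` component this is where the
odd local condition at `p` dies). [cite: Kobayashi2003, §2 p. 4 (m = −1, K_{−1} = ℚ)] -/
theorem towerSignedLocalPointsOfEmb_neg_one_zero :
    towerSignedLocalPointsOfEmb U ι W (-1) 0 = localFixedPointsOfEmb ι W ⊤ := by
  ext P
  rw [mem_towerSignedLocalPointsOfEmb_neg_one_iff]
  constructor
  · rintro ⟨h0, -, ht⟩
    rwa [localPairTraceOfEmb_self_of_mem ι W (U 0) h0] at ht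
  · intro ht
    have h0 : P ∈ localFixedPointsOfEmb ι W (U 0) := localFixedPointsOfEmb_top_le ι W (U 0) ht
    refine ⟨h0, fun m hm _ => (Nat.not_lt_zero m hm).elim, ?_⟩
    rwa [localPairTraceOfEmb_self_of_mem ι W (U 0) h0]

/-- The `m = −1` clause in isolation: for `P ∈ E⁻(K_{n,v})`, `Tr_{n/0} P ∈ E(K_{−1,v})`.
[cite: Kobayashi2003, §2 p. 4] -/
theorem localPairTraceOfEmb_zero_mem_top_of_mem_neg_one {n : ℕ} {P : localPoints W E}
    (hP : P ∈ towerSignedLocalPointsOfEmb U ι W (-1) n) :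
    localPairTraceOfEmb ι W (U 0) (U n) P ∈ localFixedPointsOfEmb ι W ⊤ :=
  hP.2.2 rfl

/-- **`E(K_{−1,v}) ≤ E^ε(K_{n,v})` for every sign and layer, provided the tower lies below `U 0`
pointwise (`U n ≤ U m` is NOT needed: on a point fixed by all of `Γ_E` every trace is multiplication
by an index, `localPairTraceOfEmb_apply_of_mem_lower`, which stays in `E(K_{−1,v}) ≤ E(K_{m,v})`).
So `E(ℚ_p) ⊆ E⁺(K_{n,v}) ∩ E⁻(K_{n,v})`. [cite: Kobayashi2003, §2 p. 4] -/
theorem localFixedPointsOfEmb_top_le_towerSignedLocalPointsOfEmb (ε : ℤˣ) (n : ℕ) :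
    localFixedPointsOfEmb ι W ⊤ ≤ towerSignedLocalPointsOfEmb U ι W ε n := by
  intro P hP
  refine ⟨localFixedPointsOfEmb_top_le ι W (U n) hP, fun m _ _ => ?_, fun _ => ?_⟩
  · rw [localPairTraceOfEmb_apply_of_mem_lower ι W (localFixedPointsOfEmb_top_le ι W (U (m + 1)) hP)]
    exact localFixedPointsOfEmb_top_le ι W (U m) (AddSubgroup.nsmul_mem _ hP _)
  · rw [localPairTraceOfEmb_apply_of_mem_lower ι W (localFixedPointsOfEmb_top_le ι W (U 0) hP)]
    exact AddSubgroup.nsmul_mem _ hP _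

end Signed

/-! ## §4 The tower `Gal(K̄/K₀·K_n)` inside `Γ_K` -/

section Tower

variable {K : Type u} [Field K] {p : ℕ} [Fact p.Prime] (κ : ZpExtension K p)
  (K₀ : Type u) [Field K₀] [Algebra K K₀]

/-- **`Gal(K̄/K₀·K_n^κ) = κ⁻¹(pⁿℤ_p) ⊓ Gal(K̄/K₀)`** — for `K = ℚ`, `κ` cyclotomic, `K₀ = ℚ(μ_p)`:
`Gal(ℚ̄/K_n)`, `K_n = ℚ(ζ_{p^{n+1}}) = ℚ(μ_p)·ℚ_n`. [cite: Kobayashi2003, §2 p. 4 (the tower K_n)] -/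
def towerSubgroup (n : ℕ) : Subgroup (Field.absoluteGaloisGroup K) :=
  κ.layerSubgroup n ⊓ galRange (K := K) K₀

/-- **`Gal(K̄/K₀·K_∞^κ) = ker κ ⊓ Gal(K̄/K₀)`** — Kobayashi's `Gal(ℚ̄/K_∞)`, `K_∞ = ∪_n K_n`.
[cite: Kobayashi2003, §2 p. 4 (K_∞)] -/
def towerTopSubgroup : Subgroup (Field.absoluteGaloisGroup K) :=
  κ.kerSubgroup ⊓ galRange (K := K) K₀

/-- Membership in `towerSubgroup`. [cite: Kobayashi2003, §2 p. 4] -/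
theorem mem_towerSubgroup_iff (n : ℕ) (σ : Field.absoluteGaloisGroup K) :
    σ ∈ towerSubgroup κ K₀ n ↔ σ ∈ κ.layerSubgroup n ∧ σ ∈ galRange (K := K) K₀ :=
  Subgroup.mem_inf

/-- Membership in `towerTopSubgroup`. [cite: Kobayashi2003, §2 p. 4] -/
theorem mem_towerTopSubgroup_iff (σ : Field.absoluteGaloisGroup K) :
    σ ∈ towerTopSubgroup κ K₀ ↔ σ ∈ κ.kerSubgroup ∧ σ ∈ galRange (K := K) K₀ :=
  Subgroup.mem_inf

/-- `K_n ⊆ K_∞`: `towerTopSubgroup ≤ towerSubgroup n`. [cite: Kobayashi2003, §2 p. 4] -/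
theorem towerTopSubgroup_le (n : ℕ) : towerTopSubgroup κ K₀ ≤ towerSubgroup κ K₀ n :=
  inf_le_inf_right _ (κ.kerSubgroup_le_layerSubgroup n)

/-- `K_m ⊆ K_n` for `m ≤ n`: the tower decreases. [cite: Kobayashi2003, §2 p. 4] -/
theorem towerSubgroup_antitone : Antitone (towerSubgroup κ K₀) :=
  fun _ _ h => inf_le_inf_right _ (κ.layerSubgroup_antitone h)

/-- `towerSubgroup n ≤ Gal(K̄/K₀)` and `towerTopSubgroup ≤ ker κ`. [cite: Kobayashi2003, §2 p. 4] -/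
theorem towerSubgroup_le_galRange (n : ℕ) : towerSubgroup κ K₀ n ≤ galRange (K := K) K₀ :=
  inf_le_right

/-- `towerTopSubgroup ≤ ker κ` (`K_∞^κ ⊆ K₀·K_∞^κ`). [cite: Kobayashi2003, §2 p. 4] -/
theorem towerTopSubgroup_le_kerSubgroup : towerTopSubgroup κ K₀ ≤ κ.kerSubgroup :=
  inf_le_left

/-- `κ⁻¹(pⁿℤ_p)` has finite index (`pⁿ`, `index_layerSubgroup`). [folklore] -/
instance finiteIndex_layerSubgroup' (n : ℕ) : (κ.layerSubgroup n).FiniteIndex :=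
  ⟨by rw [κ.index_layerSubgroup n]; exact pow_ne_zero n (Fact.out : p.Prime).ne_zero⟩

section Normal

variable [(galRange (K := K) K₀).Normal]

/-- The layers are normal in `Γ_K` (`K₀·K_n/K` Galois when `K₀/K` is). [folklore] -/
instance normal_towerSubgroup (n : ℕ) : (towerSubgroup κ K₀ n).Normal := by
  unfold towerSubgroup; infer_instance

/-- `Gal(K̄/K₀·K_∞)` is normal in `Γ_K`. [folklore] -/
instance normal_towerTopSubgroup : (towerTopSubgroup κ K₀).Normal := by
  unfold towerTopSubgroup; infer_instance

end Normal

variable [NumberField K] [NumberField K₀]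

/-- `Gal(K̄/K₀)` has finite index (`RelModel.finiteIndex_galRange`). [folklore] -/
instance finiteIndex_galRange' : (galRange (K := K) K₀).FiniteIndex :=
  RelModel.finiteIndex_galRange (K := K) K₀

/-- The layers `Gal(K̄/K₀·K_n)` have finite index. [folklore] -/
instance finiteIndex_towerSubgroup (n : ℕ) : (towerSubgroup κ K₀ n).FiniteIndex := by
  unfold towerSubgroup; infer_instance

end Tower

/-! ## §5 `Sel^ε(E/K_n)` and `Sel^ε(E/K_∞)` (Definition 2.1) -/

section Selmer

variable {K : Type u} [Field K] [NumberField K] (W : WeierstrassCurve K) {p : ℕ} [Fact p.Prime]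
  (κ : ZpExtension K p) (K₀ : Type u) [Field K₀] [NumberField K₀] [Algebra K K₀]
  (E : Type u) [Field E] [Algebra K E] [(galRange (K := K) K₀).Normal]

/-- **`Sel^ε(E/K_n)`**, Def. 2.1: `Ker( H¹(K_n, E[p^∞]) → ∏_v H¹(K_{n,v}, E[p^∞]) / E^ε(K_{n,v}) ⊗
ℚ_p/ℤ_p )` — the classical `Sel_{p^∞}` of the fixed field of `towerSubgroup κ K₀ n`
(`selmerGroupOver`) cut down, at the model `E` of the completion above `p` and every `Γ_K`-conjugate
(`conj_σ`: every place of `K_n` above it), to the classes whose local restriction lies in the Kummer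
image of `E^ε(K_{n,v})` WITH the `m = −1` clause (§3, `towerSignedLocalPointsOfEmb`).
[cite: Kobayashi2003, Def. 2.1 (p. 5)] -/
def towerSignedSelmerLayer (ε : ℤˣ) (n : ℕ) : AddSubgroup (W.subgroupH1 p (towerSubgroup κ K₀ n)) :=
  W.selmerGroupOver p (towerSubgroup κ K₀ n) ⊓
    ⨅ (σ : Field.absoluteGaloisGroup K),
      (localKummerOverOfEmb W p (towerSubgroup κ K₀ n) (closureEmb (K := K) E)
          (towerSignedLocalPointsOfEmb (towerSubgroup κ K₀) (closureEmb (K := K) E) W ε n)).comap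
        (W.conjH1 p (towerSubgroup κ K₀ n) σ)

/-- Membership in `Sel^ε(E/K_n)`. [cite: Kobayashi2003, Def. 2.1 (p. 5)] -/
theorem mem_towerSignedSelmerLayer_iff (ε : ℤˣ) (n : ℕ)
    (c : W.subgroupH1 p (towerSubgroup κ K₀ n)) :
    c ∈ towerSignedSelmerLayer W κ K₀ E ε n ↔ c ∈ W.selmerGroupOver p (towerSubgroup κ K₀ n) ∧
      ∀ σ : Field.absoluteGaloisGroup K,
        W.conjH1 p (towerSubgroup κ K₀ n) σ c ∈
          localKummerOverOfEmb W p (towerSubgroup κ K₀ n) (closureEmb (K := K) E)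
            (towerSignedLocalPointsOfEmb (towerSubgroup κ K₀) (closureEmb (K := K) E) W ε n) := by
  simp only [towerSignedSelmerLayer, AddSubgroup.mem_inf, AddSubgroup.mem_iInf, AddSubgroup.mem_comap]

/-- `Sel^ε(E/K_n) ≤ Sel_{p^∞}(E/K_n)`. [cite: Kobayashi2003, Def. 2.1 (p. 5)] -/
theorem towerSignedSelmerLayer_le_selmerGroupOver (ε : ℤˣ) (n : ℕ) :
    towerSignedSelmerLayer W κ K₀ E ε n ≤ W.selmerGroupOver p (towerSubgroup κ K₀ n) :=
  inf_le_left

/-- The signed condition at the chosen embedding itself (`σ = 1`).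
[cite: Kobayashi2003, Def. 2.1 (p. 5)] -/
theorem mem_localKummerOverOfEmb_of_mem_towerSignedSelmerLayer (ε : ℤˣ) (n : ℕ)
    {c : W.subgroupH1 p (towerSubgroup κ K₀ n)} (hc : c ∈ towerSignedSelmerLayer W κ K₀ E ε n) :
    c ∈ localKummerOverOfEmb W p (towerSubgroup κ K₀ n) (closureEmb (K := K) E)
      (towerSignedLocalPointsOfEmb (towerSubgroup κ K₀) (closureEmb (K := K) E) W ε n) := by
  have h := ((mem_towerSignedSelmerLayer_iff W κ K₀ E ε n c).mp hc).2 1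
  rwa [W.conjH1_one_holds p (towerSubgroup κ K₀ n), AddMonoidHom.id_apply] at h

/-- **`Sel^ε(E/K_∞) := lim→_n Sel^ε(E/K_n)`** inside `H¹(K_∞, E[p^∞])` (`K_∞ = K₀·K_∞^κ`): the union
of the images under the restrictions `H¹(K_n, ·) → H¹(K_∞, ·)` (`resOfLe`, `towerTopSubgroup_le`).
[cite: Kobayashi2003, Def. 2.1 (p. 5)] -/
def towerSignedSelmerInfty (ε : ℤˣ) : AddSubgroup (W.subgroupH1 p (towerTopSubgroup κ K₀)) :=
  ⨆ n : ℕ, (towerSignedSelmerLayer W κ K₀ E ε n).map (W.resOfLe p (towerTopSubgroup_le κ K₀ n))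

/-- Each `Sel^ε(E/K_n)` maps into `Sel^ε(E/K_∞)`. [cite: Kobayashi2003, Def. 2.1 (p. 5)] -/
theorem map_resOfLe_towerSignedSelmerLayer_le (ε : ℤˣ) (n : ℕ) :
    (towerSignedSelmerLayer W κ K₀ E ε n).map (W.resOfLe p (towerTopSubgroup_le κ K₀ n)) ≤
      towerSignedSelmerInfty W κ K₀ E ε :=
  le_iSup (fun n => (towerSignedSelmerLayer W κ K₀ E ε n).map
    (W.resOfLe p (towerTopSubgroup_le κ K₀ n))) n

/-- `Sel^ε(E/K_n)` is stable under the conjugation action of `Γ_K`: the classical part by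
`map_conjH1_selmerGroupOver_le_holds`, the signed conditions because `conj_σ ∘ conj_γ = conj_{σγ}`
permutes them (`conjH1_mul_holds`) — word for word `conjH1_mem_signedSelmerLayer`.
[cite: Kobayashi2003, Def. 2.1 (p. 5)] -/
theorem conjH1_mem_towerSignedSelmerLayer (ε : ℤˣ) (n : ℕ) (γ : Field.absoluteGaloisGroup K)
    {c : W.subgroupH1 p (towerSubgroup κ K₀ n)} (hc : c ∈ towerSignedSelmerLayer W κ K₀ E ε n) :
    W.conjH1 p (towerSubgroup κ K₀ n) γ c ∈ towerSignedSelmerLayer W κ K₀ E ε n := by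
  rw [mem_towerSignedSelmerLayer_iff] at hc ⊢
  refine ⟨W.map_conjH1_selmerGroupOver_le_holds p (towerSubgroup κ K₀ n) γ ⟨c, hc.1, rfl⟩,
    fun σ => ?_⟩
  rw [← AddMonoidHom.comp_apply,
    ← conjH1_mul_holds (towerSubgroup κ K₀ n) (W.geomPrimaryTorsion p) σ γ]
  exact hc.2 (σ * γ)

/-- **`Sel^ε(E/K_∞)` is stable under the conjugation action of `Γ_K`** — the action through which
`Λ = ℤ_p[[G_∞]]` "acts naturally" on the dual (p. 5); restriction commutes with conjugation
(`resOfLe_comp_conjH1_holds`). [cite: Kobayashi2003, Def. 2.1 (p. 5)] -/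
theorem conjH1_mem_towerSignedSelmerInfty (ε : ℤˣ) (γ : Field.absoluteGaloisGroup K)
    {s : W.subgroupH1 p (towerTopSubgroup κ K₀)} (hs : s ∈ towerSignedSelmerInfty W κ K₀ E ε) :
    W.conjH1 p (towerTopSubgroup κ K₀) γ s ∈ towerSignedSelmerInfty W κ K₀ E ε := by
  refine AddSubgroup.iSup_induction
    (fun n => (towerSignedSelmerLayer W κ K₀ E ε n).map (W.resOfLe p (towerTopSubgroup_le κ K₀ n)))
    (C := fun s => W.conjH1 p (towerTopSubgroup κ K₀) γ s ∈ towerSignedSelmerInfty W κ K₀ E ε)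
    hs ?_ ?_ ?_
  · rintro n s ⟨c, hc, rfl⟩
    refine map_resOfLe_towerSignedSelmerLayer_le W κ K₀ E ε n
      ⟨W.conjH1 p (towerSubgroup κ K₀ n) γ c, conjH1_mem_towerSignedSelmerLayer W κ K₀ E ε n γ hc, ?_⟩
    change ((W.resOfLe p (towerTopSubgroup_le κ K₀ n)).comp
        (W.conjH1 p (towerSubgroup κ K₀ n) γ)) c = _
    rw [resOfLe_comp_conjH1_holds]
    rfl
  · rw [map_zero]; exact zero_mem _
  · intro s t hs ht; rw [map_add]; exact add_mem hs ht

/-! ## §6 The `η`-component `Sel^ε(E/K_∞)^η` -/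

variable (η : Field.absoluteGaloisGroup K →* ℤˣ)

/-- **`Sel^ε(E/K_∞)^η = ε_η Sel^ε(E/K_∞)`** for a character `η : Γ_K →* ℤˣ` (values `±1`, read on
`ker κ = Gal(K̄/K_∞^κ)`, which surjects onto `Δ = Gal(K_∞/K_∞^κ) ≅ Gal(K_0/K)`): the classes
`s ∈ Sel^ε(E/K_∞)` with `conj_σ s = η(σ)·s` for every `σ ∈ ker κ` (p. 8: "`M^η` … is given by
`ε_η M`"; for `η` of order `≤ 2` the `η`-eigenspace). `η = ω^{(p−1)/2}`, the character of
`ℚ(√p*) ⊂ ℚ(μ_p)`, is Kobayashi's odd-branch instance; `η = 1` gives `Sel^ε(E/K_∞)^Δ`. An additive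
subgroup. TODO(general form): `η : Δ → ℤ_p^×` of order `∣ p − 1`. [cite: Kobayashi2003, §4 p. 8 (M^η = ε_η M) and §3 p. 6 (η(γ) = 1)] -/
def towerSignedSelmerInftyEta (ε : ℤˣ) : AddSubgroup (W.subgroupH1 p (towerTopSubgroup κ K₀)) where
  carrier := {s | s ∈ towerSignedSelmerInfty W κ K₀ E ε ∧
    ∀ σ ∈ κ.kerSubgroup, W.conjH1 p (towerTopSubgroup κ K₀) σ s = ((η σ : ℤˣ) : ℤ) • s}
  zero_mem' := ⟨zero_mem _, fun σ _ => by rw [map_zero, zsmul_zero]⟩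
  add_mem' := fun {a b} ha hb =>
    ⟨add_mem ha.1 hb.1, fun σ hσ => by rw [map_add, ha.2 σ hσ, hb.2 σ hσ, zsmul_add]⟩
  neg_mem' := fun {a} ha => ⟨neg_mem ha.1, fun σ hσ => by rw [map_neg, ha.2 σ hσ, zsmul_neg]⟩

/-- Membership in `Sel^ε(E/K_∞)^η`. [cite: Kobayashi2003, §4 p. 8] -/
theorem mem_towerSignedSelmerInftyEta_iff (ε : ℤˣ) (s : W.subgroupH1 p (towerTopSubgroup κ K₀)) :
    s ∈ towerSignedSelmerInftyEta W κ K₀ E η ε ↔ s ∈ towerSignedSelmerInfty W κ K₀ E ε ∧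
      ∀ σ ∈ κ.kerSubgroup,
        W.conjH1 p (towerTopSubgroup κ K₀) σ s = ((η σ : ℤˣ) : ℤ) • s :=
  Iff.rfl

/-- `Sel^ε(E/K_∞)^η ≤ Sel^ε(E/K_∞)`. [cite: Kobayashi2003, §4 p. 8] -/
theorem towerSignedSelmerInftyEta_le (ε : ℤˣ) :
    towerSignedSelmerInftyEta W κ K₀ E η ε ≤ towerSignedSelmerInfty W κ K₀ E ε :=
  fun _ hs => hs.1

/-- **`Sel^ε(E/K_∞)^η` is stable under `conj_γ` for EVERY `γ ∈ Γ_K`**: `conj_σ conj_γ =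
conj_γ conj_{γ⁻¹σγ}` (`conjH1_mul_holds`), `γ⁻¹σγ ∈ ker κ` (normal) and `η(γ⁻¹σγ) = η(σ)` (`ℤˣ`
is commutative) — so `Λ = ℤ_p[[Γ]]` acts on the `η`-component; discharges the field `conj_mem` of
`EtaSignedSelmerDualData`. [cite: Kobayashi2003, §4 p. 8 (X^±(E/K_∞)^η a ℤ_p[[Γ]]-module)] -/
theorem conjH1_mem_towerSignedSelmerInftyEta (ε : ℤˣ) (γ : Field.absoluteGaloisGroup K)
    {s : W.subgroupH1 p (towerTopSubgroup κ K₀)} (hs : s ∈ towerSignedSelmerInftyEta W κ K₀ E η ε) :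
    W.conjH1 p (towerTopSubgroup κ K₀) γ s ∈ towerSignedSelmerInftyEta W κ K₀ E η ε := by
  refine ⟨conjH1_mem_towerSignedSelmerInfty W κ K₀ E ε γ hs.1, fun σ hσ => ?_⟩
  have hσ' : γ⁻¹ * σ * γ ∈ κ.kerSubgroup := κ.kerSubgroup_normal.conj_mem' σ hσ γ
  have h1 : W.conjH1 p (towerTopSubgroup κ K₀) σ (W.conjH1 p (towerTopSubgroup κ K₀) γ s) =
      W.conjH1 p (towerTopSubgroup κ K₀) γ
        (W.conjH1 p (towerTopSubgroup κ K₀) (γ⁻¹ * σ * γ) s) := by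
    rw [← AddMonoidHom.comp_apply, ← W.conjH1_mul_holds p, ← AddMonoidHom.comp_apply,
      ← W.conjH1_mul_holds p, ← mul_assoc, ← mul_assoc, mul_inv_cancel, one_mul]
  rw [h1, hs.2 _ hσ', map_zsmul, map_mul, map_mul, map_inv, mul_right_comm, inv_mul_cancel, one_mul]

end Selmer

/-! ## §7 The Pontryagin dual `X^ε(E/K_∞)^η` as a hypothesis structure -/

section Dual

variable {K : Type u} [Field K] [NumberField K] {p : ℕ} [Fact p.Prime]

/-- **Pontryagin-dual data for `Sel^ε(E/K_∞)^η`** — field for field the tree's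
`Kobayashi2003.SignedSelmerDualData` (Def. 1.1's dual over a `ℤ_p`-extension) for the
`η`-component: the Iwasawa module `X^ε(E/K_∞)^η = Hom(Sel^ε(E/K_∞)^η, ℚ_p/ℤ_p)` ("`X^±(E/K_∞)^η` is a
torsion `ℤ_p[[Γ]]`-module", p. 8 — torsion NOT asserted here) as an abstract `Λ = ℤ_p⟦T⟧`-module `X`
with `conj_mem` (stability under `conj_γ`, dischargeable by `conjH1_mem_towerSignedSelmerInftyEta`),
`toDual : X ≃ Hom(Sel^{ε,η}_∞, ℚ/ℤ)`, `T ↔ conj_γ − 1` for `γ ∈ Gal(K̄/K₀)` with `κ γ` a generator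
("we fix a topological generator `γ ∈ Γ`… identifying `γ` with `1 + X`", p. 5), constants through
`ℤ_p → ℤ/pᵏ`. For `K = ℚ`, `κ` cyclotomic, `K₀ = ℚ(μ_p)`, `E = ℚ_[p]`, `ε = −1`, `η = ω^{(p−1)/2}`:
the object `X⁻(E/K_∞)^η` of the ODD main conjecture / Thm. 4.1 third display. NOTHING about
existence (proved Summits-side for the definitionally equal original, p281115), finite generation,
torsion (Thm. 2.2) or finite submodules is asserted.
[cite: Kobayashi2003, Def. 2.1 (p. 5), §4 p. 8 (the object only)] [cite: GreenbergLNM1716, §1 (p. 60)] -/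
structure EtaSignedSelmerDualData (W : WeierstrassCurve K) (κ : ZpExtension K p)
    (K₀ : Type u) [Field K₀] [NumberField K₀] [Algebra K K₀] [(galRange (K := K) K₀).Normal]
    (E : Type u) [Field E] [Algebra K E] (η : Field.absoluteGaloisGroup K →* ℤˣ)
    (γ : Field.absoluteGaloisGroup K) (ε : ℤˣ) where
  /-- The underlying type of the Iwasawa module `X^ε(E/K_∞)^η`. -/
  X : Type u
  /-- `X` is an abelian group. -/
  [addCommGroup : AddCommGroup X]
  /-- `X` is a `Λ = ℤ_p⟦T⟧`-module. -/
  [module : Module (IwasawaAlgebra p) X]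
  /-- `Sel^ε(E/K_∞)^η` is stable under conjugation by `γ` (holds by
  `conjH1_mem_towerSignedSelmerInftyEta`). -/
  conj_mem : ∀ s ∈ towerSignedSelmerInftyEta W κ K₀ E η ε,
    W.conjH1 p (towerTopSubgroup κ K₀) γ s ∈ towerSignedSelmerInftyEta W κ K₀ E η ε
  /-- The identification of `X` with the character group `Hom(Sel^{ε,η}_∞, ℚ/ℤ)`. -/
  toDual : X →+ (towerSignedSelmerInftyEta W κ K₀ E η ε →+ AddCircle (1 : ℚ))
  /-- `toDual` is a group isomorphism. -/
  bijective : Function.Bijective toDual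
  /-- `T` acts as `γ - 1`: `(T·x)(s) = x(conj_γ s) - x(s)`. -/
  toDual_T_smul : ∀ (x : X) (s : towerSignedSelmerInftyEta W κ K₀ E η ε),
    toDual ((PowerSeries.X : IwasawaAlgebra p) • x) s =
      toDual x ⟨W.conjH1 p (towerTopSubgroup κ K₀) γ s, conj_mem s s.2⟩ - toDual x s
  /-- Constants `c ∈ ℤ_p` act on `pᵏ`-torsion classes through `ℤ_p → ℤ/pᵏ`. -/
  toDual_C_smul : ∀ (c : ℤ_[p]) (x : X) (s : towerSignedSelmerInftyEta W κ K₀ E η ε) (k : ℕ),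
    (p ^ k) • s = 0 → toDual (PowerSeries.C c • x) s = (PadicInt.toZModPow k c).val • toDual x s

namespace EtaSignedSelmerDualData

variable {W : WeierstrassCurve K} {κ : ZpExtension K p} {K₀ : Type u} [Field K₀] [NumberField K₀]
  [Algebra K K₀] [(galRange (K := K) K₀).Normal] {E : Type u} [Field E] [Algebra K E]
  {η : Field.absoluteGaloisGroup K →* ℤˣ} {γ : Field.absoluteGaloisGroup K} {ε : ℤˣ}

/-- The dual of a datum is an abelian group (instance on the new type `D.X`; no library instance is
touched). [cite: Kobayashi2003, §4 p. 8 (the object only)] -/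
instance instAddCommGroupX (D : EtaSignedSelmerDualData W κ K₀ E η γ ε) : AddCommGroup D.X :=
  D.addCommGroup

/-- The dual of a datum is a `Λ`-module (instance on `D.X`). [cite: Kobayashi2003, §4 p. 8 (the object only)] -/
instance instModuleX (D : EtaSignedSelmerDualData W κ K₀ E η γ ε) : Module (IwasawaAlgebra p) D.X :=
  D.module

variable (D : EtaSignedSelmerDualData W κ K₀ E η γ ε)

/-- The **characteristic ideal** `Char(X^ε(E/K_∞)^η) ⊆ ℤ_p[[Γ]]` (`Module.charIdeal`) — the object of
Kobayashi's main conjectures at `η` ("`Char(X⁻(E/K_∞)^η) = ((1/X)·L_p⁻(E, η, X))`" for `η ≠ 1`,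
§4 p. 8; NOT asserted). [cite: Kobayashi2003, §4 p. 8 (the object only)] -/
def charIdeal : Ideal (IwasawaAlgebra p) :=
  Literature.NumberTheory.EllipticCurves.Module.charIdeal (IwasawaAlgebra p) D.X

/-- The **`μ`-invariant** of `X^ε(E/K_∞)^η` (`muInvariant`; junk `0` unless finitely generated
torsion). [cite: Kobayashi2003, §4 p. 8 (the object only)] -/
def mu : ℕ :=
  muInvariant p D.X

/-- The **`λ`-invariant** of `X^ε(E/K_∞)^η` (`lambdaInvariant`; junk `0` unless finitely generated
torsion). [cite: Kobayashi2003, §4 p. 8 (the object only)] -/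
def lambda : ℕ :=
  lambdaInvariant p D.X

end EtaSignedSelmerDualData

end Dual

end Literature.NumberTheory.EllipticCurves.Kobayashi2003

end
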